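import Literature.NumberTheory.LFunctions.WeilGroundStateRealZerosProofs
import Literature.NumberTheory.ConnesConsani2021.ArchimedeanSoninTrace
import HarnessLib

/-!
# Connes–Consani 2021, Lemma 3.1: the vanishing conditions as the range of `Q`, and the reduction
# `g ∗ g* = Q(k ∗ k*)`, `k̂(0) = −2 ĝ(0)` of the proof of Theorem 6.11 — PROVED

A. Connes, C. Consani, *Weil positivity and trace formula, the archimedean place*, Selecta Math.
(N.S.) 27 (2021), Paper No. 77 = arXiv:2006.13771 [bib: `ConnesConsani2021`]; §3 Lemma 3.1
(= Lemma 14 of the arXiv text, p. 12) and the first step of the proof of Theorem 6.11 (= Thm. 44,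
§6.7, p. 29).  Typed in the additive variable `t = log ρ` of the tree
(`Literature/NumberTheory/LFunctions/WeilExplicit.lean`: `IsWeilTest`, `weilConv`, `weilReflect`;
`Literature.NumberTheory.ConnesConsani2021.mulFourier` for CC's `f̂(s) = ∫ f(u) u^{-is} d*u`), so that
CC's `ρ∂_ρ` is `d/dt`, their operator `Q := −(ρ∂_ρ)² + ¼` is `opQ h = −h'' + h/4`, and their
`k = Y ∗ g`, `Y(ρ) = ρ^{1/2} 1_{ρ ≥ 1}`, i.e. `k(u) = u^{1/2} ∫₀^u v^{-1/2} g(v) d*v`, is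
`k(t) = e^{t/2} ∫_{-a}^{t} g(τ) e^{-τ/2} dτ` for `g` supported in the window `[-a, a]`
(`a = ½ log 2` is CC's interval `[2^{-1/2}, 2^{1/2}]`; any `a` here).

What is PROVED here, following the printed proofs:

* **Lemma 3.1 (ii)** (p. 12): for `h ∈ C_c^∞`, `Q h ∈ C_c^∞` lies in the ideal `𝒥` of the two
  vanishing conditions `f̂(± i/2) = 0` and `supp Q h ⊆ supp h` — `isWeilTest_opQ`,
  `tsupport_opQ_subset`, `mulFourier_opQ_I_half`, `mulFourier_opQ_neg_I_half`, through the Fourier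
  relation of the proof of Lemma 3.1 (iv), `(Q h)^(s) = (¼ + s²) ĥ(s)` — `mulFourier_opQ`.
* **Lemma 3.1 (iii)** (p. 12): for `f ∈ C_c^∞` supported in `I = [-a, a]` with `f̂(± i/2) = 0` there
  is `g ∈ C_c^∞` supported in `I` with `Q g = f`, namely `g = Y* ∗ Y ∗ f` — `exists_opQ_eq`
  (two applications of the tree's primitive construction
  `Literature.NumberTheory.LFunctions.ConnesVanSuijlekom.exists_primitive`, which is exactly CC's
  `k = Y ∗ f`: "the vanishing conditions give `∫_I v^{-1/2} f(v) d*v = 0` and this shows that the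
  function `k(u) := u^{1/2} ∫₀^u v^{-1/2} f(v) d*v` vanishes when `u ∉ I`").
* **Proof of Theorem 6.11, first step** (p. 29): for `g ∈ C_c^∞([2^{-1/2}, 2^{1/2}])` with
  `ĝ(−i/2) = 0`, the function `k = Y ∗ g` is in `C_c^∞` with support in the same interval,
  `Q(k ∗ k*) = g ∗ g*` and `k̂(0) = −2 ĝ(0)` — `exists_halfPrimitive`; hence the constant
  `(γ / log 2)|k̂(0)|² = (4γ / log 2)|ĝ(0)|²` of Theorem 6.11 — `thm611_constant_eq`.

Lemma 3.1 (i) (the vanishing conditions cut out an ideal: evaluation of `f̂` at a point is a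
character of the convolution algebra) and (iv) (positive-definiteness of `f` iff of `g`, i.e. the
Fourier relation `mulFourier_opQ` read through Bochner's theorem) are not typed beyond
`mulFourier_opQ`.  Together with `RankOnePositivity.lean` (Lemma 6.9, the deduction of Lemma 6.10)
this leaves, of §6.7's proof of Theorem 6.11 (`WeilArchPositivity_soninTrace_fine`, a named fact),
exactly the two imported identities `Tr(ϑ(f)𝐒) = W_∞(f) + E(f)` (Thm. 4.7) and
`E∘Q(k ∗ k*) = ⟨ξ|N_I ξ⟩` (Prop. 5.5) and the floating-point inputs of §6 outside the kernel
(`HOME/lit/CC2021-RIGOUR-MAP.md` of cell `pub-rhdoor`).  No RH claim; no named fact is introduced.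
-/

noncomputable section

open MeasureTheory Set Complex
open scoped ComplexConjugate

namespace Literature.NumberTheory.ConnesConsani2021

open Literature.NumberTheory.LFunctions Literature.NumberTheory.LFunctions.ConnesVanSuijlekom

variable {f g h k : ℝ → ℂ} {a : ℝ}

/-! ## The operator `Q = −(ρ∂_ρ)² + ¼` -/

/-- Connes–Consani's second-order operator `Q := −(ρ∂_ρ)² + ¼` on `C_c^∞(ℝ₊*)` (Lemma 3.1 (iii),
eq. (Q), p. 12), in the additive variable `t = log ρ` (`ρ∂_ρ = d/dt`): `(Q h)(t) = −h''(t) + h(t)/4`.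
[cite: ConnesConsani2021, Lemma 3.1 §3 p. 12] -/
def opQ (h : ℝ → ℂ) : ℝ → ℂ := fun t ↦ -deriv (deriv h) t + (1 / 4 : ℂ) * h t

/-- Unfolding `opQ`. [cite: ConnesConsani2021, Lemma 3.1 §3 p. 12] -/
theorem opQ_apply (h : ℝ → ℂ) (t : ℝ) : opQ h t = -deriv (deriv h) t + (1 / 4 : ℂ) * h t := rfl

/-- `Q h` as a sum of two scaled test functions. [folklore] -/
private theorem opQ_eq_add (h : ℝ → ℂ) :
    opQ h = (fun t ↦ (-1 : ℂ) * deriv (deriv h) t) + fun t ↦ (1 / 4 : ℂ) * h t := by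
  funext t; simp [opQ]

/-- **Lemma 3.1 (ii), smoothness**: `Q` maps `C_c^∞` to `C_c^∞`. [cite: ConnesConsani2021, Lemma 3.1 (ii) §3 p. 12] -/
theorem isWeilTest_opQ (hh : IsWeilTest h) : IsWeilTest (opQ h) := by
  rw [opQ_eq_add]
  exact (hh.deriv.deriv.const_mul (-1)).add (hh.const_mul (1 / 4))

/-- **Lemma 3.1 (ii), support**: "`(−(ρ∂_ρ)² + ¼) g` vanishes identically outside the support of
`g`": `supp Q h ⊆ supp h`. [cite: ConnesConsani2021, Lemma 3.1 (ii) §3 p. 12] -/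
theorem tsupport_opQ_subset (h : ℝ → ℂ) : tsupport (opQ h) ⊆ tsupport h := by
  rw [opQ_eq_add]
  refine (tsupport_add _ _).trans (union_subset ?_ ?_)
  · exact (tsupport_mul_subset_right).trans
      ((tsupport_deriv_subset).trans tsupport_deriv_subset)
  · exact tsupport_mul_subset_right

/-- **The Fourier relation of Lemma 3.1** (proof of (iv), p. 12: "the Fourier transforms are related
by the equality `(¼ + t²) ĝ(t) = f̂(t)`" for `f = Q g`): `(Q h)^(s) = (¼ + s²) ĥ(s)` for every test
function `h` and complex `s` (integration by parts twice, `weilMellin_deriv_deriv`).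
[cite: ConnesConsani2021, Lemma 3.1 (iv) §3 p. 12 (proof)] -/
theorem mulFourier_opQ (hh : IsWeilTest h) (s : ℂ) :
    mulFourier (opQ h) s = (1 / 4 + s ^ 2) * mulFourier h s := by
  have hd : IsWeilTest (deriv (deriv h)) := hh.deriv.deriv
  rw [mulFourier_eq_weilMellin, mulFourier_eq_weilMellin, opQ_eq_add,
    weilMellin_add (hd.const_mul _).1.continuous (hd.const_mul _).2 (hh.const_mul _).1.continuous
      (hh.const_mul _).2,
    weilMellin_const_mul, weilMellin_const_mul, weilMellin_deriv_deriv hh]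
  have hI : (1 / 2 - I * s - 1 / 2) ^ 2 = -s ^ 2 := by
    ring_nf; rw [I_sq]; ring
  rw [hI]; ring

/-- **Lemma 3.1 (ii), vanishing at `i/2`**: `(Q h)^(i/2) = 0`. [cite: ConnesConsani2021, Lemma 3.1 (ii) §3 p. 12] -/
theorem mulFourier_opQ_I_half (hh : IsWeilTest h) : mulFourier (opQ h) (I / 2) = 0 := by
  rw [mulFourier_opQ hh]
  have : (1 / 4 + (I / 2) ^ 2 : ℂ) = 0 := by ring_nf; rw [I_sq]; ring
  rw [this, zero_mul]

/-- **Lemma 3.1 (ii), vanishing at `−i/2`**: `(Q h)^(−i/2) = 0`. [cite: ConnesConsani2021, Lemma 3.1 (ii) §3 p. 12] -/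
theorem mulFourier_opQ_neg_I_half (hh : IsWeilTest h) : mulFourier (opQ h) (-(I / 2)) = 0 := by
  rw [mulFourier_opQ hh]
  have : (1 / 4 + (-(I / 2)) ^ 2 : ℂ) = 0 := by ring_nf; rw [I_sq]; ring
  rw [this, zero_mul]

/-! ## `k = Y ∗ g`: the half-primitive of the proof of Theorem 6.11 -/

/-- From `ĝ(−i/2) = 0` in CC's normalisation to the tree's `∫ g(t) e^{-t/2} dt = 0`. [folklore] -/
private theorem integral_mul_cexp_neg_half_eq_zero (h0 : mulFourier g (-(I / 2)) = 0) :
    ∫ t : ℝ, g t * cexp (-(1 / 2 : ℂ) * t) = 0 := by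
  rw [mulFourier_neg_I_half, weilMellin] at h0
  rw [← h0]
  congr 1; funext t; congr 2; ring

/-- From `ĝ(i/2) = 0` to `∫ g(t) e^{t/2} dt = 0`. [folklore] -/
private theorem integral_mul_cexp_half_eq_zero (h1 : mulFourier g (I / 2) = 0) :
    ∫ t : ℝ, g t * cexp ((1 / 2 : ℂ) * t) = 0 := by
  rw [mulFourier_I_half, weilMellin] at h1
  rw [← h1]
  congr 1; funext t; congr 2; ring

/-- For a test function `k`: `k' ∗ (k')* = −(k ∗ k*)''` (the derivative is skew for the
translation-invariant pairing; `(k*)' = −(k')*`). [folklore] -/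
private theorem weilConv_deriv_weilReflect_deriv (hk : IsWeilTest k) :
    weilConv (deriv k) (weilReflect (deriv k))
      = fun t ↦ -deriv (deriv (weilConv k (weilReflect k))) t := by
  rw [deriv_weilConv_left hk hk.weilReflect.1.continuous,
    deriv_weilConv_right hk.deriv.1.continuous hk.weilReflect]
  have e : deriv (weilReflect k) = fun t ↦ (-1 : ℂ) * weilReflect (deriv k) t := by
    funext t
    have h1 : weilReflect (deriv k) t = -deriv (weilReflect k) t := congr_fun (weilReflect_deriv k) t
    rw [h1]; ring
  rw [e, weilConv_const_mul_right]
  funext t; ring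

/-- **`Q(k ∗ k*) = (k' − k/2) ∗ (k' − k/2)*`** for a test function `k`: the factorisation
`Q = (½ − ρ∂_ρ)(½ + ρ∂_ρ)` transported through the involution (proof of Thm. 6.11, p. 29:
"`k ∗ k* = Y* ∗ Y ∗ f`, thus `Q(k ∗ k*) = g ∗ g*`"). [cite: ConnesConsani2021, Thm. 6.11 §6.7 p. 29 (proof)] -/
theorem opQ_weilConv_weilReflect (hk : IsWeilTest k) :
    opQ (weilConv k (weilReflect k))
      = weilConv (fun t ↦ deriv k t + -(1 / 2 : ℂ) * k t)
          (weilReflect fun t ↦ deriv k t + -(1 / 2 : ℂ) * k t) := by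
  rw [weilConv_weilReflect_deriv_add_mul hk, weilConv_deriv_weilReflect_deriv hk]
  have c1 : conj (-(1 / 2 : ℂ)) - -(1 / 2 : ℂ) = 0 := by
    rw [map_neg, map_div₀, map_one, map_ofNat]; ring
  have c2 : (Complex.normSq (-(1 / 2 : ℂ)) : ℂ) = 1 / 4 := by
    rw [Complex.normSq_neg, Complex.normSq_eq_norm_sq]; norm_num
  funext t
  rw [opQ_apply, c1, c2]; ring

/-- **Connes–Consani 2021, proof of Theorem 6.11, first step** (§6.7, p. 29, using Lemma 3.1 (iii)
p. 12), additive avatar on a symmetric window `[-a, a]` (CC: `a = ½ log 2`).  Let `g ∈ C_c^∞` have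
support in `[-a, a]` and `ĝ(−i/2) = 0`.  Then `k := Y ∗ g`, i.e.
`k(t) = e^{t/2} ∫_{-a}^{t} g(τ) e^{-τ/2} dτ` (`= u^{1/2} ∫₀^u v^{-1/2} g(v) d*v` at `u = e^t`), is again
a test function with support in `[-a, a]` ("`0 = ĝ(−i/2) = ∫₀^∞ v^{-1/2} g(v) d*v`, thus the support
of `k` is contained in `[2^{-1/2}, 2^{1/2}]`"), it solves `(ρ∂_ρ − ½) k = g`, and
`Q(k ∗ k*) = g ∗ g*`, `k̂(0) = −2 ĝ(0)` (the display "`Q(k ∗ k*) = g ∗ g* = f`,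
`k̂(0) = −2 ĝ(0)`" of the proof, the second equality obtained in print by integration by parts; here
from `(k')^(½) = 0`). [cite: ConnesConsani2021, Thm. 6.11 §6.7 p. 29 (proof); Lemma 3.1 (iii) §3 p. 12] -/
theorem exists_halfPrimitive (hg : IsWeilTest g) (hgs : tsupport g ⊆ Icc (-a) a)
    (h0 : mulFourier g (-(I / 2)) = 0) :
    ∃ k : ℝ → ℂ, IsWeilTest k ∧ tsupport k ⊆ Icc (-a) a ∧
      (∀ t : ℝ, k t = cexp (t / 2) * ∫ τ in (-a)..t, g τ * cexp (-(τ / 2))) ∧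
      (∀ t : ℝ, deriv k t - (1 / 2 : ℂ) * k t = g t) ∧
      opQ (weilConv k (weilReflect k)) = weilConv g (weilReflect g) ∧
      mulFourier k 0 = -2 * mulFourier g 0 := by
  obtain ⟨k, hk, hks, hkd, hkf⟩ :=
    exists_primitive hg hgs (-(1 / 2 : ℂ)) (integral_mul_cexp_neg_half_eq_zero h0)
  have hfun : (fun t ↦ deriv k t + -(1 / 2 : ℂ) * k t) = g := funext hkd
  refine ⟨k, hk, hks, fun t => ?_, fun t => ?_, ?_, ?_⟩
  · -- the printed formula `k(u) = u^{1/2} ∫₀^u v^{-1/2} g(v) d*v`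
    rw [hkf t]
    have e1 : cexp (-(-(1 / 2 : ℂ) * (t : ℂ))) = cexp ((t : ℂ) / 2) := by congr 1; ring
    rw [e1]
    congr 1
    refine intervalIntegral.integral_congr fun τ _ => ?_
    congr 2; ring
  · have := hkd t
    linear_combination this
  · rw [opQ_weilConv_weilReflect hk, hfun]
  · -- `k̂(0) = −2 ĝ(0)`: integrate `k' − k/2 = g` (`∫ k' = 0`, `weilMellin_deriv` at `s = ½`)
    rw [mulFourier_zero, mulFourier_zero]
    have h : weilMellin (fun t ↦ deriv k t + -(1 / 2 : ℂ) * k t) (1 / 2) = weilMellin g (1 / 2) := by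
      rw [hfun]
    rw [show (fun t ↦ deriv k t + -(1 / 2 : ℂ) * k t) = deriv k + fun t ↦ -(1 / 2 : ℂ) * k t from
        rfl,
      weilMellin_add hk.deriv.1.continuous hk.deriv.2 (hk.const_mul _).1.continuous
        (hk.const_mul _).2,
      weilMellin_const_mul, weilMellin_deriv hk] at h
    linear_combination (-2 : ℂ) * h

/-- **The constant of Theorem 6.11** (end of the proof, p. 29): with `⟨η₀|ξ⟩ = (log 2)^{-1/2} k̂(0)`
and `k̂(0) = −2 ĝ(0)`, `γ |⟨η₀|ξ⟩|² = (γ/log 2) |k̂(0)|² = (4γ/log 2) |ĝ(0)|²`, i.e. `c = 4γ/log 2`.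
The arithmetic, for any `k, g` with `k̂(0) = −2 ĝ(0)` and any `γ`. [cite: ConnesConsani2021, Thm. 6.11 §6.7 p. 29 (proof)] -/
theorem thm611_constant_eq (hkg : mulFourier k 0 = -2 * mulFourier g 0) (γ : ℝ) :
    γ / Real.log 2 * ‖mulFourier k 0‖ ^ 2 = 4 * γ / Real.log 2 * ‖mulFourier g 0‖ ^ 2 := by
  rw [hkg, norm_mul, norm_neg, Complex.norm_ofNat]
  ring

/-! ## Lemma 3.1 (iii): `𝒥 ∩ C_c^∞(I) = Q(C_c^∞(I))` -/

/-- **Connes–Consani 2021, Lemma 3.1 (iii)** (arXiv Lemma 14 (iii), p. 12): "Let `f ∈ C_c^∞(ℝ₊*)`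
with support in an interval `I`, fulfill the vanishing conditions [`f̂(± i/2) = 0`].  Then there
exists `g ∈ C_c^∞(ℝ₊*)` with support in `I` and such that `Q(g) := (−(ρ∂_ρ)² + ¼) g = f`.  One has
`g = Y* ∗ Y ∗ f`."  Additive avatar for a symmetric window `I = [-a, a]` (the case used in the paper,
`I = [2^{-1/2}, 2^{1/2}]`); proof as printed: `k = Y ∗ f` is supported in `I` because
`f̂(−i/2) = 0`, then `∫_I u^{1/2} k(u) d*u = 0` ("using again integration by parts and
(vanishing)"; here: `k̂(i/2) = 0` from `f̂(i/2) = 0`) so that the second primitive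
`g(ρ) = ρ^{-1/2} ∫_ρ^∞ u^{1/2} k(u) d*u = (Y* ∗ k)(ρ)` — in the additive variable
`−e^{-t/2} ∫_{-a}^{t} k(τ) e^{τ/2} dτ` — is supported in `I`, and `Q g = f`.
TODO(general form): an arbitrary compact interval `I = [α, β]` (translate the window).
[cite: ConnesConsani2021, Lemma 3.1 (iii) §3 p. 12] -/
theorem exists_opQ_eq (hf : IsWeilTest f) (hfs : tsupport f ⊆ Icc (-a) a)
    (h1 : mulFourier f (I / 2) = 0) (h2 : mulFourier f (-(I / 2)) = 0) :
    ∃ g : ℝ → ℂ, IsWeilTest g ∧ tsupport g ⊆ Icc (-a) a ∧ opQ g = f := by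
  -- `k = Y ∗ f`: `k' − k/2 = f`, supported in the window since `f̂(−i/2) = 0`
  obtain ⟨k, hk, hks, hkd, -⟩ :=
    exists_primitive hf hfs (-(1 / 2 : ℂ)) (integral_mul_cexp_neg_half_eq_zero h2)
  have hfun : (fun t ↦ deriv k t + -(1 / 2 : ℂ) * k t) = f := funext hkd
  -- `k̂(i/2) = 0` from `f̂(i/2) = 0`: `f̂(i/2) = (k')^(1) − ½ k̂(1) = −k̂(1)` in the tree's `weilMellin`
  have hk1 : mulFourier k (I / 2) = 0 := by
    have h : weilMellin (fun t ↦ deriv k t + -(1 / 2 : ℂ) * k t) 1 = weilMellin f 1 := by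
      rw [hfun]
    rw [show (fun t ↦ deriv k t + -(1 / 2 : ℂ) * k t) = deriv k + fun t ↦ -(1 / 2 : ℂ) * k t from
        rfl,
      weilMellin_add hk.deriv.1.continuous hk.deriv.2 (hk.const_mul _).1.continuous
        (hk.const_mul _).2,
      weilMellin_const_mul, weilMellin_deriv hk, ← mulFourier_I_half, ← mulFourier_I_half, h1] at h
    linear_combination (-1 : ℂ) * h
  -- second primitive `v' + v/2 = k`, supported in the window; `g := −v`
  obtain ⟨v, hv, hvs, hvd, -⟩ :=
    exists_primitive hk hks (1 / 2 : ℂ) (integral_mul_cexp_half_eq_zero hk1)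
  refine ⟨fun t ↦ (-1 : ℂ) * v t, hv.const_mul (-1), tsupport_mul_subset_right.trans hvs, ?_⟩
  -- `Q(−v) = v'' − v/4 = (v' + v/2)' − ½ (v' + v/2) = k' − k/2 = f`
  have hvd' : deriv v = fun t ↦ k t - (1 / 2 : ℂ) * v t := by
    funext t; have := hvd t; linear_combination this
  have hdiff : ∀ t, DifferentiableAt ℝ v t := fun t ↦ (hv.1.differentiable (by simp)) t
  have hkdiff : ∀ t, DifferentiableAt ℝ k t := fun t ↦ (hk.1.differentiable (by simp)) t
  have hd1 : deriv (fun t ↦ (-1 : ℂ) * v t) = fun t ↦ (-1 : ℂ) * deriv v t := by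
    funext t; exact deriv_const_mul _ (hdiff t)
  have hd2 : deriv (fun t ↦ (-1 : ℂ) * deriv v t) = fun t ↦ (-1 : ℂ) * deriv (deriv v) t := by
    funext t; exact deriv_const_mul _ ((hv.deriv.1.differentiable (by simp)) t)
  have hvdd : deriv (deriv v) = fun t ↦ deriv k t - (1 / 2 : ℂ) * (k t - (1 / 2 : ℂ) * v t) := by
    funext t
    rw [hvd', deriv_fun_sub (hkdiff t) ((hdiff t).const_mul _), deriv_const_mul _ (hdiff t), hvd']
  funext t
  rw [opQ_apply, hd1, hd2]
  simp only
  rw [hvdd]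
  simp only
  have := hkd t
  linear_combination this

end Literature.NumberTheory.ConnesConsani2021

end
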